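import Literature.AlgebraicGeometry.Resolution.NearPointColengthDropScheme
import Literature.AlgebraicGeometry.Resolution.ColengthOffCentre
import HarnessLib

/-!
# No infinite chain of curve blow-ups dominating one curve (CoP1, Prop. 4.4: "`n(i)` eventually drops") —
# the generic-point argument IN CHAIN FORM

Topic: `Literature/AlgebraicGeometry/Resolution`. [CoP1] = Cossart–Piltant, J. Algebra 320 (2008) 1051–1082, proof of Prop. 4.4,
p. 10: "Working above the generic point `η(i)` of some one dimensional component of `Σ(i)`, we have `J𝒪_{X(i),η(i)}` principal
for `i >> 0` (this is a consequence of [47] appendix 5, theorem 3 and (E) on p. 391); hence `n(i)` eventually drops." The local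
statement is PROVED in the tree three times over: `length_quotient_weakTransform_lt_of_near` (`NearPointColengthDrop.lean`,
Huneke–Swanson 14.3.4), its scheme-level step `IsBlowup.length_quotient_stalkIdeal_controlledTransform_lt_of_isNear(_of_mem_maxPoints)`
(`NearPointColengthDropScheme.lean`: at a NEAR point over the generic point `η` of a curve centre, `dim 𝒪_η = 2`, the colength of the
weak transform drops, and it is finite at a maximal point of `V(J)`), Zariski's App. 5 Thm. 3 itself
(`finite_idealBaseTree_of_isRegularLocalRing`, `BaseTreeFiniteKonig.lean`); off the centre the colength does not change
(`IsBlowup.length_quotient_stalkIdeal_controlledTransform_eq_of_not_mem_support`, `ColengthOffCentre.lean`). This file is the CHAIN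
PACKAGING consumed by the assembly of Prop. 4.4 — gap **T3** of the res-hironaka inputs cell (`plan/inputs/F71-CENSUS-v0.md`,
CRIT-PASS-v1 R1 / RULING R8; named fact `CossartPiltant2008_prop44`, `IdealisticExponentResolution.lean`), in the chain language of
`false_of_nearChain_tau_two` (`NearChainTermination.lean`):

* `IsBlowup.colength_weakTransform_le` / `IsBlowup.colength_weakTransform_lt` — ONE blowing up `π : X' → X` along `Y ⊆ {ord = μ}`, a
  point `x'` of the weak transform of order `μ` over `x = π x'`: `λ(𝒪_{X',x'}/J'_{x'}) ≤ λ(𝒪_{X,x}/J_x)` always (equality off `Y`),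
  and `<` when `x ∈ Y` has `𝓘_{Y,x} = 𝔪_x` (the generic point of its component of `Y`), `𝒪_{X,x}` regular of embedding dimension `2`,
  `J_x` of finite colength;
* `nearChain_colength_succ_le` / `_succ_lt` / `nearChain_colength_add_card_le` — along an infinite tower `X_0 ← X_1 ← ⋯` of such
  blowing ups with weak transforms `J_{n+1} = π_nᶜ(J_n, μ)` and a compatible chain `y_n ∈ X_n` (`π_n y_{n+1} = y_n`) of order-`μ` points
  with regular two-dimensional local rings, generic on the centres through them (steps whose centre MISSES `y_n` are allowed — there
  `π_n` is a local isomorphism at `y_{n+1}`): `λ_n + #{k < n | y_k ∈ Y_k} ≤ λ_0` in `ℕ∞`;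
* `finite_setOf_mem_centre_of_nearChain_dim_two` — **if `λ_0 < ∞` the chain meets the centres only finitely often**, indeed at most
  `λ_0` times (`ncard_setOf_mem_centre_of_nearChain_le`); `finite_setOf_mem_centre_of_nearChain_maxPoints` — the same with the local
  hypotheses discharged from geometry (`GenericPointStalkData.lean`: `Y_n ∋ y_n ⇒ Y_n = cl{y_n}`, `coheight y_n = 2`, `y_0` a maximal
  point of `V(J_0)`);
* `false_of_curveGenericChain` — **no infinite chain** of blowing ups `π n` along curves `Y n = cl{η n} ⊆ {ord (J n) = μ}`, `η n` a
  maximal point of `V(J n)` with regular two-dimensional local ring, `π n (η (n+1)) = η n` — the signature of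
  `stub_T3_false_of_curveGenericChain` of `plan/inputs/candidates/F71_T1_T4_SIGNATURES.lean` (res-inputs-p-8a) VERBATIM;
  `false_of_curveGenericChain_of_frequently` — the lineage form with idle steps (signature of res-inputs-p-8a's draft
  `candidates/F71_T3_CurveGenericChainTermination_p8a.lean`, sha16 48ce230787379a8e, whose well-founded-order proof this file replaces by
  the counting bound).

Reading for the assembly: a one-dimensional component of `Σ` can be the centre (at its generic point) of only finitely many of the blowing
ups of any permissible sequence along which its generic point keeps order `μ`. `CossartPiltant2008_prop44` itself is NOT proved here;
resolution in dimension `≥ 4` / positive characteristic is NOT proved. AI-written (res-inputs-p-8b, with res-inputs-p-8a's statements);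
AI review is weaker than expert review.

## Sources

* V. Cossart, O. Piltant, J. Algebra 320 (2008) 1051–1082, proof of Prop. 4.4, p. 10. [CossartPiltant2008]
* O. Zariski, P. Samuel, *Commutative Algebra* II (1960), Appendix 5, Thm. 3 and (E) p. 391. [ZariskiSamuel1960]
* C. Huneke, I. Swanson, *Integral Closure of Ideals, Rings, and Modules* (2006), Lemma 14.3.4. [HunekeSwanson2006]
-/

noncomputable section

open CategoryTheory AlgebraicGeometry TopologicalSpace IsLocalRing

namespace Literature.AlgebraicGeometry.Resolution

universe u

open Scheme.IdealSheafData

/-! ## §1 One step -/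

section Step

variable {X X' : Scheme.{u}} [IsLocallyNoetherian X] [IsLocallyNoetherian X'] {π : X' ⟶ X} {Y : Closeds X}
  {J : X.IdealSheafData} {μ : ℕ}

/-- **One blowing up: the colength of the weak transform at an order-`μ` point does not increase** — off the centre it is
unchanged (`ColengthOffCentre.lean`); over the generic point of a component of the centre with regular two-dimensional local ring it
drops when finite (`NearPointColengthDropScheme.lean`) and is `⊤ ≥` anything otherwise. [cite: CossartPiltant2008, proof of Prop. 4.4] -/
theorem IsBlowup.colength_weakTransform_le (hπ : IsBlowup π (vanishingIdeal Y)) (hμ : 1 ≤ μ)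
    (hY : ∀ y ∈ (Y : Set X), idealOrder J y = μ) {x' : X'} {x : X} (hx : π x' = x)
    (hnear : idealOrder (controlledTransform π (vanishingIdeal Y) J μ) x' = μ)
    (hreg : IsRegularLocalRing (X.presheaf.stalk x)) (hdim : (maximalIdeal (X.presheaf.stalk x)).spanFinrank = 2)
    (hgen : x ∈ (Y : Set X) → stalkIdeal (vanishingIdeal Y) x = maximalIdeal (X.presheaf.stalk x)) :
    Module.length (X'.presheaf.stalk x')
        (X'.presheaf.stalk x' ⧸ stalkIdeal (controlledTransform π (vanishingIdeal Y) J μ) x') ≤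
      Module.length (X.presheaf.stalk x) (X.presheaf.stalk x ⧸ stalkIdeal J x) := by
  subst hx
  haveI := hreg
  by_cases hmem : π x' ∈ (Y : Set X)
  · by_cases hfin : IsFiniteLength (X.presheaf.stalk (π x')) (X.presheaf.stalk (π x') ⧸ stalkIdeal J (π x'))
    · exact (hπ.length_quotient_stalkIdeal_controlledTransform_lt_of_isNear hμ hY (hgen hmem) hdim hfin hnear).le
    · rw [← Module.length_ne_top_iff, not_ne_iff] at hfin
      rw [hfin]
      exact le_top
  · have hxC : π x' ∉ (vanishingIdeal Y).support := by
      rwa [← SetLike.mem_coe, Scheme.IdealSheafData.coe_support_vanishingIdeal]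
    exact (hπ.length_quotient_stalkIdeal_controlledTransform_eq_of_not_mem_support J μ hxC).le

/-- **One blowing up through the point: the colength drops** (the scheme-level step of the tree, re-indexed along `π x' = x`).
[cite: CossartPiltant2008, proof of Prop. 4.4] [cite: HunekeSwanson2006, Lemma 14.3.4] -/
theorem IsBlowup.colength_weakTransform_lt (hπ : IsBlowup π (vanishingIdeal Y)) (hμ : 1 ≤ μ)
    (hY : ∀ y ∈ (Y : Set X), idealOrder J y = μ) {x' : X'} {x : X} (hx : π x' = x)
    (hnear : idealOrder (controlledTransform π (vanishingIdeal Y) J μ) x' = μ)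
    (hreg : IsRegularLocalRing (X.presheaf.stalk x)) (hdim : (maximalIdeal (X.presheaf.stalk x)).spanFinrank = 2)
    (hgen : stalkIdeal (vanishingIdeal Y) x = maximalIdeal (X.presheaf.stalk x))
    (hfin : IsFiniteLength (X.presheaf.stalk x) (X.presheaf.stalk x ⧸ stalkIdeal J x)) :
    Module.length (X'.presheaf.stalk x')
        (X'.presheaf.stalk x' ⧸ stalkIdeal (controlledTransform π (vanishingIdeal Y) J μ) x') <
      Module.length (X.presheaf.stalk x) (X.presheaf.stalk x ⧸ stalkIdeal J x) := by
  subst hx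
  haveI := hreg
  exact hπ.length_quotient_stalkIdeal_controlledTransform_lt_of_isNear hμ hY hgen hdim hfin hnear

end Step

/-! ## §2 Along a tower: the chain form -/

section Chain

variable (Xs : ℕ → Scheme.{u}) [∀ n, IsLocallyNoetherian (Xs n)] (π : ∀ n, Xs (n + 1) ⟶ Xs n)
  (Y : ∀ n, Closeds (Xs n)) (J : ∀ n, (Xs n).IdealSheafData) {μ : ℕ} (hμ : 1 ≤ μ)
  (hπ : ∀ n, IsBlowup (π n) (vanishingIdeal (Y n)))
  (hJ : ∀ n, J (n + 1) = controlledTransform (π n) (vanishingIdeal (Y n)) (J n) μ)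
  (hY : ∀ n, ∀ y ∈ (Y n : Set (Xs n)), idealOrder (J n) y = μ)
  (y : ∀ n, Xs n) (hy : ∀ n, π n (y (n + 1)) = y n) (hord : ∀ n, idealOrder (J n) (y n) = μ)
  (hreg : ∀ n, IsRegularLocalRing ((Xs n).presheaf.stalk (y n)))
  (hdim : ∀ n, (maximalIdeal ((Xs n).presheaf.stalk (y n))).spanFinrank = 2)
  (hgen : ∀ n, y n ∈ (Y n : Set (Xs n)) →
    stalkIdeal (vanishingIdeal (Y n)) (y n) = maximalIdeal ((Xs n).presheaf.stalk (y n)))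

include hμ hπ hJ hY hy hord hreg hdim hgen in
/-- **Along the chain the colength never increases.** [cite: CossartPiltant2008, proof of Prop. 4.4] -/
theorem nearChain_colength_succ_le (n : ℕ) :
    Module.length ((Xs (n + 1)).presheaf.stalk (y (n + 1)))
        ((Xs (n + 1)).presheaf.stalk (y (n + 1)) ⧸ stalkIdeal (J (n + 1)) (y (n + 1))) ≤
      Module.length ((Xs n).presheaf.stalk (y n)) ((Xs n).presheaf.stalk (y n) ⧸ stalkIdeal (J n) (y n)) := by
  have hnear : idealOrder (controlledTransform (π n) (vanishingIdeal (Y n)) (J n) μ) (y (n + 1)) = μ := by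
    rw [← hJ n]; exact hord (n + 1)
  have h := (hπ n).colength_weakTransform_le hμ (hY n) (hy n) hnear (hreg n) (hdim n) (hgen n)
  rw [hJ n]
  exact h

include hμ hπ hJ hY hy hord hreg hdim hgen in
/-- **At a step whose centre passes through `y_n` the colength drops** (when finite).
[cite: CossartPiltant2008, proof of Prop. 4.4] -/
theorem nearChain_colength_succ_lt {n : ℕ} (hmem : y n ∈ (Y n : Set (Xs n)))
    (hfin : IsFiniteLength ((Xs n).presheaf.stalk (y n)) ((Xs n).presheaf.stalk (y n) ⧸ stalkIdeal (J n) (y n))) :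
    Module.length ((Xs (n + 1)).presheaf.stalk (y (n + 1)))
        ((Xs (n + 1)).presheaf.stalk (y (n + 1)) ⧸ stalkIdeal (J (n + 1)) (y (n + 1))) <
      Module.length ((Xs n).presheaf.stalk (y n)) ((Xs n).presheaf.stalk (y n) ⧸ stalkIdeal (J n) (y n)) := by
  have hnear : idealOrder (controlledTransform (π n) (vanishingIdeal (Y n)) (J n) μ) (y (n + 1)) = μ := by
    rw [← hJ n]; exact hord (n + 1)
  have h := (hπ n).colength_weakTransform_lt hμ (hY n) (hy n) hnear (hreg n) (hdim n) (hgen n hmem) hfin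
  rw [hJ n]
  exact h

include hμ hπ hJ hY hy hord hreg hdim hgen in
/-- **The counting inequality**: writing `λ n = λ(𝒪_{X_n,y_n}/J_{n,y_n})`, `λ n + #{k < n | y_k ∈ Y_k} ≤ λ 0` in `ℕ∞`.
[cite: CossartPiltant2008, proof of Prop. 4.4] -/
theorem nearChain_colength_add_card_le (ℓ : ℕ → ℕ∞)
    (hℓ : ∀ n, ℓ n = Module.length ((Xs n).presheaf.stalk (y n)) ((Xs n).presheaf.stalk (y n) ⧸ stalkIdeal (J n) (y n)))
    (hfin : IsFiniteLength ((Xs 0).presheaf.stalk (y 0)) ((Xs 0).presheaf.stalk (y 0) ⧸ stalkIdeal (J 0) (y 0)))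
    (n : ℕ) :
    haveI := Classical.dec
    ℓ n + (((Finset.range n).filter fun k => y k ∈ (Y k : Set (Xs k))).card : ℕ∞) ≤ ℓ 0 := by
  classical
  induction n with
  | zero => simp
  | succ n ih =>
    have h0 : ℓ 0 ≠ ⊤ := by rw [hℓ 0]; exact Module.length_ne_top_iff.mpr hfin
    have hn : ℓ n ≠ ⊤ := by
      intro htop
      apply h0
      rw [htop, top_add] at ih
      exact eq_top_iff.mpr ih
    rw [Finset.range_add_one, Finset.filter_insert]
    by_cases hmem : y n ∈ (Y n : Set (Xs n))
    · rw [if_pos hmem, Finset.card_insert_of_notMem (by simp), Nat.cast_add, Nat.cast_one]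
      have hfinn : IsFiniteLength ((Xs n).presheaf.stalk (y n)) ((Xs n).presheaf.stalk (y n) ⧸ stalkIdeal (J n) (y n)) := by
        rw [← Module.length_ne_top_iff, ← hℓ n]; exact hn
      have hlt : ℓ (n + 1) < ℓ n := by
        rw [hℓ (n + 1), hℓ n]
        exact nearChain_colength_succ_lt Xs π Y J hμ hπ hJ hY y hy hord hreg hdim hgen hmem hfinn
      have h1 : ℓ (n + 1) + 1 ≤ ℓ n := (ENat.add_one_le_iff (ne_top_of_lt hlt)).mpr hlt
      calc ℓ (n + 1) + ((((Finset.range n).filter fun k => y k ∈ (Y k : Set (Xs k))).card : ℕ∞) + 1)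
          = (ℓ (n + 1) + 1) + (((Finset.range n).filter fun k => y k ∈ (Y k : Set (Xs k))).card : ℕ∞) := by ring
        _ ≤ ℓ n + (((Finset.range n).filter fun k => y k ∈ (Y k : Set (Xs k))).card : ℕ∞) := add_le_add h1 le_rfl
        _ ≤ ℓ 0 := ih
    · rw [if_neg hmem]
      have hle : ℓ (n + 1) ≤ ℓ n := by
        rw [hℓ (n + 1), hℓ n]
        exact nearChain_colength_succ_le Xs π Y J hμ hπ hJ hY y hy hord hreg hdim hgen n
      calc ℓ (n + 1) + (((Finset.range n).filter fun k => y k ∈ (Y k : Set (Xs k))).card : ℕ∞)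
          ≤ ℓ n + (((Finset.range n).filter fun k => y k ∈ (Y k : Set (Xs k))).card : ℕ∞) := add_le_add hle le_rfl
        _ ≤ ℓ 0 := ih

include hμ hπ hJ hY hy hord hreg hdim hgen in
/-- **[CoP1] Prop. 4.4, THE GENERIC-POINT ARGUMENT IN CHAIN FORM (T3).** Along an infinite tower of blowing ups
`π_n : X_{n+1} → X_n` of locally Noetherian schemes along centres `Y_n ⊆ {ord J_n = μ}` (`μ ≥ 1`), `J_{n+1}` the weak (controlled)
transform of `J_n`, let `y_n ∈ X_n` be a compatible chain (`π_n y_{n+1} = y_n`) of points of order `μ` whose local rings are regular of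
embedding dimension `2`, each centre through `y_n` having `𝓘_{Y_n, y_n} = 𝔪_{y_n}` (i.e. `y_n` is the generic point of its component of
`Y_n`). If `J_0` has finite colength at `y_0`, then the chain passes through the centres only FINITELY often: each passage strictly
lowers `λ(𝒪_{X_n,y_n}/J_{n,y_n})`, passages elsewhere keep it. [cite: CossartPiltant2008, proof of Prop. 4.4]
[cite: ZariskiSamuel1960, Appendix 5, Thm. 3] -/
theorem finite_setOf_mem_centre_of_nearChain_dim_two
    (hfin : IsFiniteLength ((Xs 0).presheaf.stalk (y 0)) ((Xs 0).presheaf.stalk (y 0) ⧸ stalkIdeal (J 0) (y 0))) :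
    {n | y n ∈ (Y n : Set (Xs n))}.Finite := by
  classical
  set ℓ : ℕ → ℕ∞ := fun n =>
    Module.length ((Xs n).presheaf.stalk (y n)) ((Xs n).presheaf.stalk (y n) ⧸ stalkIdeal (J n) (y n)) with hℓdef
  have hℓ : ∀ n, ℓ n = Module.length ((Xs n).presheaf.stalk (y n)) ((Xs n).presheaf.stalk (y n) ⧸ stalkIdeal (J n) (y n)) :=
    fun n => rfl
  by_contra hinf
  have h0 : ℓ 0 ≠ ⊤ := Module.length_ne_top_iff.mpr hfin
  obtain ⟨l₀, hl₀⟩ := ENat.ne_top_iff_exists.mp h0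
  obtain ⟨t, ht, hcard⟩ := Set.Infinite.exists_subset_card_eq hinf (l₀ + 1)
  -- all of `t` lies below `N = sup t + 1`
  set N := t.sup id + 1 with hN
  have htN : t ⊆ (Finset.range N).filter fun k => y k ∈ (Y k : Set (Xs k)) := by
    intro k hk
    rw [Finset.mem_filter, Finset.mem_range]
    exact ⟨Nat.lt_succ_of_le (Finset.le_sup (f := id) hk), ht hk⟩
  have hle := nearChain_colength_add_card_le Xs π Y J hμ hπ hJ hY y hy hord hreg hdim hgen ℓ hℓ hfin N
  have hcardle : ((l₀ + 1 : ℕ) : ℕ∞) ≤ (((Finset.range N).filter fun k => y k ∈ (Y k : Set (Xs k))).card : ℕ∞) := by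
    rw [← hcard]
    exact_mod_cast Finset.card_le_card htN
  have : ((l₀ + 1 : ℕ) : ℕ∞) ≤ (l₀ : ℕ∞) := by
    calc ((l₀ + 1 : ℕ) : ℕ∞) ≤ (((Finset.range N).filter fun k => y k ∈ (Y k : Set (Xs k))).card : ℕ∞) := hcardle
      _ ≤ ℓ N + (((Finset.range N).filter fun k => y k ∈ (Y k : Set (Xs k))).card : ℕ∞) := le_add_self
      _ ≤ ℓ 0 := hle
      _ = l₀ := hl₀.symm
  have := ENat.coe_le_coe.mp this
  omega

include hμ hπ hJ hY hy hord hreg hdim hgen in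
/-- **The bound**: the chain passes through the centres at most `λ(𝒪_{X_0,y_0}/J_{0,y_0})` times.
[cite: CossartPiltant2008, proof of Prop. 4.4] -/
theorem ncard_setOf_mem_centre_of_nearChain_le
    (hfin : IsFiniteLength ((Xs 0).presheaf.stalk (y 0)) ((Xs 0).presheaf.stalk (y 0) ⧸ stalkIdeal (J 0) (y 0))) :
    ({n | y n ∈ (Y n : Set (Xs n))}.ncard : ℕ∞) ≤
      Module.length ((Xs 0).presheaf.stalk (y 0)) ((Xs 0).presheaf.stalk (y 0) ⧸ stalkIdeal (J 0) (y 0)) := by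
  classical
  set ℓ : ℕ → ℕ∞ := fun n =>
    Module.length ((Xs n).presheaf.stalk (y n)) ((Xs n).presheaf.stalk (y n) ⧸ stalkIdeal (J n) (y n)) with hℓdef
  have hℓ : ∀ n, ℓ n = Module.length ((Xs n).presheaf.stalk (y n)) ((Xs n).presheaf.stalk (y n) ⧸ stalkIdeal (J n) (y n)) :=
    fun n => rfl
  have hfinS := finite_setOf_mem_centre_of_nearChain_dim_two Xs π Y J hμ hπ hJ hY y hy hord hreg hdim hgen hfin
  set t := hfinS.toFinset with ht
  set N := t.sup id + 1 with hN
  have htN : t ⊆ (Finset.range N).filter fun k => y k ∈ (Y k : Set (Xs k)) := by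
    intro k hk
    rw [Finset.mem_filter, Finset.mem_range]
    exact ⟨Nat.lt_succ_of_le (Finset.le_sup (f := id) hk), by simpa [ht] using hk⟩
  have hle := nearChain_colength_add_card_le Xs π Y J hμ hπ hJ hY y hy hord hreg hdim hgen ℓ hℓ hfin N
  calc ({n | y n ∈ (Y n : Set (Xs n))}.ncard : ℕ∞) = (t.card : ℕ∞) := by
        rw [ht, Set.ncard_eq_toFinset_card _ hfinS]
    _ ≤ (((Finset.range N).filter fun k => y k ∈ (Y k : Set (Xs k))).card : ℕ∞) := by
        exact_mod_cast Finset.card_le_card htN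
    _ ≤ ℓ N + (((Finset.range N).filter fun k => y k ∈ (Y k : Set (Xs k))).card : ℕ∞) := le_add_self
    _ ≤ ℓ 0 := hle

end Chain

/-! ## §3 The geometric form: generic points of curves of `Σ` on a threefold -/

/-- **T3 for the curves of `Σ` on a threefold.** Along an infinite tower of blowing ups `π_n` of locally Noetherian schemes along
centres `Y_n ⊆ {ord J_n = μ}` (`μ ≥ 1`, weak transforms), let `y_n` be a compatible chain of points of order `μ`, each of
codimension `2` with regular local ring (the generic point of a curve of `Σ(n)` on a regular threefold), such that every centre through
`y_n` is the closure of `y_n` (the curve itself — on a threefold a regular integral centre inside `Σ ∌` generic point through the generic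
point of a curve of `Σ` is that curve), and let `y_0` be a maximal point of `V(J_0)` (`J_0` is `𝔪`-primary at `y_0`). Then only
finitely many of the `Y_n` pass through `y_n`: "working above the generic point `η(i)` … `J𝒪_{X(i),η(i)}` principal for `i >> 0`;
hence `n(i)` eventually drops". [cite: CossartPiltant2008, proof of Prop. 4.4] [cite: ZariskiSamuel1960, Appendix 5, Thm. 3] -/
theorem finite_setOf_mem_centre_of_nearChain_maxPoints (Xs : ℕ → Scheme.{u}) [∀ n, IsLocallyNoetherian (Xs n)]
    (π : ∀ n, Xs (n + 1) ⟶ Xs n) (Y : ∀ n, Closeds (Xs n)) (J : ∀ n, (Xs n).IdealSheafData) {μ : ℕ} (hμ : 1 ≤ μ)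
    (hπ : ∀ n, IsBlowup (π n) (vanishingIdeal (Y n)))
    (hJ : ∀ n, J (n + 1) = controlledTransform (π n) (vanishingIdeal (Y n)) (J n) μ)
    (hY : ∀ n, ∀ y ∈ (Y n : Set (Xs n)), idealOrder (J n) y = μ)
    (y : ∀ n, Xs n) (hy : ∀ n, π n (y (n + 1)) = y n) (hord : ∀ n, idealOrder (J n) (y n) = μ)
    (hreg : ∀ n, IsRegularLocalRing ((Xs n).presheaf.stalk (y n))) (hcodim : ∀ n, Order.coheight (y n) = 2)
    (hcl : ∀ n, y n ∈ (Y n : Set (Xs n)) → (Y n : Set (Xs n)) = closure {y n})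
    (hmax : y 0 ∈ maxPoints ((J 0).support : Set (Xs 0))) :
    {n | y n ∈ (Y n : Set (Xs n))}.Finite :=
  finite_setOf_mem_centre_of_nearChain_dim_two Xs π Y J hμ hπ hJ hY y hy hord hreg
    (fun n => by haveI := hreg n; exact spanFinrank_maximalIdeal_stalk_eq (y n) (hcodim n))
    (fun n hn => stalkIdeal_vanishingIdeal_eq_maximalIdeal_of_closure_eq (hcl n hn))
    (isFiniteLength_quotient_stalkIdeal_of_mem_maxPoints hmax)

/-! ## §4 The stub signatures of the inputs cell (`stub_T3_false_of_curveGenericChain` and the lineage form) -/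

/-- **[CoP1] Prop. 4.4, "`n(i)` eventually drops": there is no infinite chain of blowing ups of curves each dominating the previous
one** — signature of `stub_T3_false_of_curveGenericChain` (`plan/inputs/candidates/F71_T1_T4_SIGNATURES.lean`) verbatim. Let
`X₀ ← X₁ ← ⋯` be blowing ups `π n` of locally Noetherian schemes along closed subsets `Y n = cl{η n} ⊆ {ord (J n) = μ}` (`μ ≥ 1`), `η n`
a maximal point of `V(J n)` with regular local ring and `coheight = 2`, `π n (η (n+1)) = η n`, `J (n+1)` the weak transform of `J n`.
This is absurd: every step meets the chain, and the colengths `λ(𝒪_{X_n,η_n}/(J n)_{η_n})` are finite and strictly decrease.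
[cite: CossartPiltant2008, Prop. 4.4 (proof, p. 10)] [cite: ZariskiSamuel1960, Appendix 5, Thm. 3] -/
theorem false_of_curveGenericChain (Xs : ℕ → Scheme.{u})
    (hN : ∀ n, IsLocallyNoetherian (Xs n))
    (π : ∀ n, Xs (n + 1) ⟶ Xs n) (Y : ∀ n, Closeds (Xs n)) (η : ∀ n, Xs n)
    (J : ∀ n, (Xs n).IdealSheafData) {μ : ℕ} (hμ : 1 ≤ μ)
    (hπ : ∀ n, IsBlowup (π n) (vanishingIdeal (Y n)))
    (hJ : ∀ n, J (n + 1) = controlledTransform (π n) (vanishingIdeal (Y n)) (J n) μ)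
    (hYη : ∀ n, ((Y n : Closeds (Xs n)) : Set (Xs n)) = closure {η n})
    (hYord : ∀ n, ∀ y ∈ (Y n : Set (Xs n)), idealOrder (J n) y = μ)
    (hη : ∀ n, π n (η (n + 1)) = η n)
    (hreg : ∀ n, IsRegularLocalRing ((Xs n).presheaf.stalk (η n)))
    (hmax : ∀ n, η n ∈ maxPoints ((J n).support : Set (Xs n)))
    (hcodim : ∀ n, Order.coheight (η n) = 2) : False := by
  haveI := hN
  have hmem : ∀ n, η n ∈ (Y n : Set (Xs n)) := fun n => by
    rw [hYη n]
    exact subset_closure rfl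
  have hfin := finite_setOf_mem_centre_of_nearChain_maxPoints Xs π Y J hμ hπ hJ hYord η hη
    (fun n => hYord n _ (hmem n)) hreg hcodim (fun n _ => hYη n) (hmax 0)
  have huniv : {n | η n ∈ (Y n : Set (Xs n))} = Set.univ := Set.eq_univ_of_forall hmem
  rw [huniv] at hfin
  exact Set.infinite_univ hfin

/-- **The lineage form with idle steps** (signature of res-inputs-p-8a's draft `false_of_curveGenericChain_of_frequently`): a lineage
`η n` of order-`μ` maximal points of the `V(J n)` (regular local rings, `coheight = 2`) followed through a run of blowing ups `π n` along
`Y n ⊆ {ord = μ}`, each step either the blowing up of the lineage's own curve (`Y n = cl{η n}`) or a step whose centre misses `η n`,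
cannot blow up the lineage's curve infinitely often. [cite: CossartPiltant2008, Prop. 4.4 (proof, p. 10)] -/
theorem false_of_curveGenericChain_of_frequently (Xs : ℕ → Scheme.{u})
    (hN : ∀ n, IsLocallyNoetherian (Xs n))
    (π : ∀ n, Xs (n + 1) ⟶ Xs n) (Y : ∀ n, Closeds (Xs n)) (η : ∀ n, Xs n)
    (J : ∀ n, (Xs n).IdealSheafData) {μ : ℕ} (hμ : 1 ≤ μ)
    (hπ : ∀ n, IsBlowup (π n) (vanishingIdeal (Y n)))
    (hJ : ∀ n, J (n + 1) = controlledTransform (π n) (vanishingIdeal (Y n)) (J n) μ)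
    (hYord : ∀ n, ∀ y ∈ (Y n : Set (Xs n)), idealOrder (J n) y = μ)
    (hη : ∀ n, π n (η (n + 1)) = η n)
    (hord : ∀ n, idealOrder (J n) (η n) = μ)
    (hreg : ∀ n, IsRegularLocalRing ((Xs n).presheaf.stalk (η n)))
    (hmax : ∀ n, η n ∈ maxPoints ((J n).support : Set (Xs n)))
    (hcodim : ∀ n, Order.coheight (η n) = 2)
    (hstep : ∀ n, ((Y n : Closeds (Xs n)) : Set (Xs n)) = closure {η n} ∨ η n ∉ (Y n : Set (Xs n)))
    (hhit : ∀ N, ∃ n, N ≤ n ∧ ((Y n : Closeds (Xs n)) : Set (Xs n)) = closure {η n}) : False := by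
  haveI := hN
  have hcl : ∀ n, η n ∈ (Y n : Set (Xs n)) → ((Y n : Closeds (Xs n)) : Set (Xs n)) = closure {η n} := fun n hn => by
    rcases hstep n with h | h
    · exact h
    · exact absurd hn h
  have hfin := finite_setOf_mem_centre_of_nearChain_maxPoints Xs π Y J hμ hπ hJ hYord η hη hord hreg hcodim hcl (hmax 0)
  refine Set.infinite_of_not_bddAbove ?_ hfin
  rintro ⟨N, hN'⟩
  obtain ⟨n, hNn, hYn⟩ := hhit (N + 1)
  have hmem : η n ∈ (Y n : Set (Xs n)) := by
    rw [hYn]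
    exact subset_closure rfl
  have := hN' hmem
  omega

end Literature.AlgebraicGeometry.Resolution

end
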